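import Summits.BirchSwinnertonDyer.Rank1Residual.Supersingular.SignedRankZero
import HarnessLib

/-!
# Rank `0`, ANY prime `p` with `E[p]` irreducible: a "level reading" `ord_p(L(E,1)/Ω_E) ≤ ord_p #Ш(E)(p) + d`
# in Miller's currency — the LOWER half when `d ≤ ord_p ∏ c_ℓ`, and `ord_p ∏ c_ℓ ≤ d` granted the UPPER half
# (cell `b2b-bsdres`, team n1011, row T-N10K, seat `b2b-bsdres-n1011-p11`; `p`-generic bookkeeping for rows T-a2 / T-a4 / T-a2r1)

HONEST FRAMING (run/shared/lean/b2b/bsd-rank1-residual/, verbatim in every file): the goal of the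
cell is to DELETE the COMBINATION-SHAPED residual classes of the Birch–Swinnerton-Dyer formula for
ALL analytic-rank `≤ 1` elliptic curves over `ℚ` — "full BSD formula for every rank `≤ 1` curve in
class `C`" assembled STRICTLY from published theorems — so that the rank-`≤ 1` remainder becomes
exactly the CONSTRUCTION-SHAPED classes, which are TYPED (missing-input `Prop`s), NOT attempted.
This is not "finishing BSD". Team n1011: prove what is provable now; shrink each hard class to its
core with data; no claim beyond stated classes. Nothing booked; no label changes; theorems only.

## What this file does (pure bookkeeping, no named fact, no Kurihara number)

The companion `X4/KuriharaLowerHalf.lean` consumes Kim 2026 Thm. 1.8 (6) beyond the unit case at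
`p ≥ 5`: a Kurihara number non-zero modulo `p^k` yields the READING
`ord_p(L(E,1)/Ω(W)) ≤ ord_p #Ш(E)(p) + (k − 1)`. The `p = 3` analogue of that reading is the business
of team rows T-a2 (census-typed statement) and T-a4 (Kim–Pollack 2025, announced, typed OPEN); both
produce, per pair, a reading of the SAME shape with some slack `d`. This file isolates the
`p`-GENERIC step from such a reading to Miller's currency, so that every producer (Kim at `p ≥ 5`,
the `p = 3` inputs, or any future source) plugs in with one line:

* `missingLowerBoundAt_rankZero_of_levelReading`: rank `0`, `E[p]` irreducible (kills the torsion
  term), a reading with slack `d ≤ ord_p ∏ c_ℓ` ⟹ `Typed.MissingLowerBoundAt W p`;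
* `padicValNat_tamagawaProduct_le_of_levelReading_of_missingUpperBoundAt`: granted the UPPER half,
  a reading with slack `d` forces `ord_p ∏ c_ℓ ≤ d` — so readings with slack `< ord_p ∏ c_ℓ` do not
  exist (`not_levelReading_of_missingUpperBoundAt_of_lt`): the currency-level form of "every Kurihara
  number of level `≤ ord_p ∏ c_ℓ` vanishes";
* `bsdp_rankZero_of_levelReading_of_missingUpperBoundAt`: reading with `d ≤ ord_p ∏ c_ℓ` ∧ UPPER ⟹
  `BSD(E,p)`;
* `padicValRat_shaAn_eq_of_levelReading_eq`: an EXACT reading (`=` with slack `d`) gives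
  `ord_p #Ш_an = ord_p #Ш + (d − ord_p ∏ c_ℓ)`, whence `BSD(E,p) ↔ d = ord_p ∏ c_ℓ`
  (`bsdp_iff_of_levelReading_eq`) — the currency form of Kim's expected equality
  `∂^{(∞)}(δ̃) = ∑_ℓ ord_p c_ℓ` (§1.5.3 of arXiv:2203.12159), generalising additive-p3's
  `X4.bsdp_iff_not_dvd_tamagawaProduct_of_rankZero_witness` (`d = 0`).

Inputs: GZK (`hGZK`, for `rank E(ℚ) = 0`, `Reg = 1`, `Ш` finite) and the rank-zero bookkeeping of
`Supersingular/SignedRankZero.lean` (`shaAn_eq_of_analyticRank_eq_zero`, `padicValRat_shaAn_witness`).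
References: Miller 2011 [Miller2011LMS] Def. 1.1; Kim 2026 [Kim2022StructureSelmer] Thm. 1.9 (6), §1.5.3.
-/

noncomputable section

open scoped Classical

open WeierstrassCurve Literature.NumberTheory.EllipticCurves
  Literature.NumberTheory.EllipticCurves.Rank1Residual
  Literature.NumberTheory.EllipticCurves.Rank1Residual.Typed
  Summit.BirchSwinnertonDyer.Rank1Residual.Supersingular

namespace Summit.BirchSwinnertonDyer.Rank1Residual.X4

variable (W : WeierstrassCurve ℚ) [W.IsElliptic] [W.IsGloballyMinimal] (p : ℕ) [hp : Fact p.Prime]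

omit [W.IsGloballyMinimal] in
/-- **A level reading in Miller's currency.** Rank `0` (`L(E,1) ≠ 0`), `E[p]` irreducible, GZK: a
reading `L(E,1)/Ω(W) = q₀`, `ord_p q₀ ≤ ord_p #Ш(E)(p) + d` gives `#Ш_an = q` with
`ord_p q + ord_p ∏ c_ℓ ≤ ord_p #Ш + d` (`#Ш_an = q₀·#T²/∏c_ℓ`, `p ∤ #T`). Bookkeeping.
[cite: Miller2011LMS, Def. 1.1 (arXiv:1010.2431 p. 3)] -/
theorem padicValRat_shaAn_le_of_levelReading (hGZK : rank_eq_analyticRank_of_analyticRank_le_one)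
    (hirr : Irr W p) (hL : W.entireLFunction 1 ≠ 0) (d : ℕ)
    (hread : ∃ q : ℚ, W.entireLFunction 1 / (W.realPeriodRat : ℂ) = (q : ℂ) ∧
      padicValRat p q ≤ (padicValNat p (Nat.card (AddCommGroup.primaryComponent W.sha p)) : ℤ) + d) :
    ∃ q : ℚ, shaAn W = (q : ℂ) ∧
      padicValRat p q + padicValNat p W.tamagawaProduct ≤ padicValNat p W.shaOrder + (d : ℤ) := by
  have hr0 : W.analyticRank = 0 := analyticRank_eq_zero_of_entireLFunction_one_ne_zero W hL
  obtain ⟨-, hfin⟩ := hGZK W (by rw [hr0]; exact zero_le_one)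
  haveI : Finite W.sha := hfin
  obtain ⟨t, ht, hval⟩ := hread
  have hΩC : (W.realPeriodRat : ℂ) ≠ 0 := Complex.ofReal_ne_zero.mpr W.realPeriodRat_pos_holds.ne'
  have ht0 : t ≠ 0 := by
    rintro rfl
    apply hL
    have h := ht
    rw [div_eq_iff hΩC] at h
    rw [h]; simp
  have hsha : padicValNat p (Nat.card (AddCommGroup.primaryComponent W.sha p)) =
      padicValNat p W.shaOrder := by
    unfold WeierstrassCurve.shaOrder
    exact padicValNat_card_addPrimaryComponent p
  refine ⟨t * (W.torsionOrder : ℚ) ^ 2 / (W.tamagawaProduct : ℚ),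
    shaAn_eq_of_analyticRank_eq_zero W hGZK hr0 ht, ?_⟩
  rw [padicValRat_shaAn_witness W p hirr ht0, ← hsha]
  linarith

omit [W.IsGloballyMinimal] in
/-- **The LOWER half from a level reading with slack `d ≤ ord_p ∏ c_ℓ`** (rank `0`, any prime `p`,
`E[p]` irreducible, GZK): `Typed.MissingLowerBoundAt W p`. At `p ≥ 5` the reading comes from a level-`k`
Kurihara number (`d = k − 1`, `X4/KuriharaLowerHalf.lean`); at `p = 3` from the inputs of rows
T-a2 / T-a4. Per pair. [cite: Miller2011LMS, Def. 1.1 (arXiv:1010.2431 p. 3)] -/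
theorem missingLowerBoundAt_rankZero_of_levelReading
    (hGZK : rank_eq_analyticRank_of_analyticRank_le_one) (hirr : Irr W p)
    (hL : W.entireLFunction 1 ≠ 0) {d : ℕ} (hd : d ≤ padicValNat p W.tamagawaProduct)
    (hread : ∃ q : ℚ, W.entireLFunction 1 / (W.realPeriodRat : ℂ) = (q : ℂ) ∧
      padicValRat p q ≤ (padicValNat p (Nat.card (AddCommGroup.primaryComponent W.sha p)) : ℤ) + d) :
    MissingLowerBoundAt W p := by
  obtain ⟨q, hq, hv⟩ := padicValRat_shaAn_le_of_levelReading W p hGZK hirr hL d hread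
  refine ⟨q, hq, ?_⟩
  have hd' : (d : ℤ) ≤ (padicValNat p W.tamagawaProduct : ℤ) := by exact_mod_cast hd
  linarith

omit [W.IsGloballyMinimal] in
/-- **Granted the UPPER half, a level reading with slack `d` forces `ord_p ∏ c_ℓ ≤ d`** (rank `0`,
any prime `p`, `E[p]` irreducible, GZK; uniqueness of the rational value of `#Ш_an`). The currency
form of "`∂^{(∞)}(δ̃) ≥ ∑ ord_p c_ℓ` on rows with a kernel upper half".
[cite: Miller2011LMS, Def. 1.1 (arXiv:1010.2431 p. 3)] [cite: Kim2022StructureSelmer, §1.5.3 (PDF p. 8)] -/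
theorem padicValNat_tamagawaProduct_le_of_levelReading_of_missingUpperBoundAt
    (hGZK : rank_eq_analyticRank_of_analyticRank_le_one) (hirr : Irr W p)
    (hL : W.entireLFunction 1 ≠ 0) (hup : MissingUpperBoundAt W p) (d : ℕ)
    (hread : ∃ q : ℚ, W.entireLFunction 1 / (W.realPeriodRat : ℂ) = (q : ℂ) ∧
      padicValRat p q ≤ (padicValNat p (Nat.card (AddCommGroup.primaryComponent W.sha p)) : ℤ) + d) :
    padicValNat p W.tamagawaProduct ≤ d := by
  obtain ⟨q, hq, hv⟩ := padicValRat_shaAn_le_of_levelReading W p hGZK hirr hL d hread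
  obtain ⟨q', hq', hv'⟩ := hup
  have hqq : q' = q := by exact_mod_cast hq'.symm.trans hq
  subst hqq
  have : (padicValNat p W.tamagawaProduct : ℤ) ≤ d := by linarith
  exact_mod_cast this

omit [W.IsGloballyMinimal] in
/-- **No level reading with slack `< ord_p ∏ c_ℓ` once the UPPER half holds** (rank `0`, any `p`,
`E[p]` irreducible, GZK) — the currency form of "every Kurihara number of level `k ≤ ord_p ∏ c_ℓ`
vanishes" (`X4/KuriharaLowerHalf.lean` §2 at `p ≥ 5`). [cite: Miller2011LMS, Def. 1.1 (arXiv:1010.2431 p. 3)] -/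
theorem not_levelReading_of_missingUpperBoundAt_of_lt
    (hGZK : rank_eq_analyticRank_of_analyticRank_le_one) (hirr : Irr W p)
    (hL : W.entireLFunction 1 ≠ 0) (hup : MissingUpperBoundAt W p) {d : ℕ}
    (hd : d < padicValNat p W.tamagawaProduct) :
    ¬ ∃ q : ℚ, W.entireLFunction 1 / (W.realPeriodRat : ℂ) = (q : ℂ) ∧
      padicValRat p q ≤ (padicValNat p (Nat.card (AddCommGroup.primaryComponent W.sha p)) : ℤ) + d :=
  fun hread => absurd
    (padicValNat_tamagawaProduct_le_of_levelReading_of_missingUpperBoundAt W p hGZK hirr hL hup d hread)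
    (not_le.mpr hd)

omit [W.IsGloballyMinimal] in
/-- **`BSD(E,p)` from a level reading with slack `d ≤ ord_p ∏ c_ℓ` and the UPPER half** (rank `0`,
any `p`, `E[p]` irreducible, GZK). [cite: Miller2011LMS, Def. 1.1 (arXiv:1010.2431 p. 3)] -/
theorem bsdp_rankZero_of_levelReading_of_missingUpperBoundAt
    (hGZK : rank_eq_analyticRank_of_analyticRank_le_one) (hirr : Irr W p)
    (hL : W.entireLFunction 1 ≠ 0) {d : ℕ} (hd : d ≤ padicValNat p W.tamagawaProduct)
    (hread : ∃ q : ℚ, W.entireLFunction 1 / (W.realPeriodRat : ℂ) = (q : ℂ) ∧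
      padicValRat p q ≤ (padicValNat p (Nat.card (AddCommGroup.primaryComponent W.sha p)) : ℤ) + d)
    (hup : MissingUpperBoundAt W p) : BSDp W p :=
  bsdp_of_missingPPartAt W p hGZK
    (by rw [analyticRank_eq_zero_of_entireLFunction_one_ne_zero W hL]; exact zero_le_one)
    (missingPPartAt_of_lower_of_upper W p
      (missingLowerBoundAt_rankZero_of_levelReading W p hGZK hirr hL hd hread) hup)

omit [W.IsGloballyMinimal] in
/-- **An EXACT level reading** `ord_p(L(E,1)/Ω(W)) = ord_p #Ш(E)(p) + d` (what Kim's clause (6) says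
with `d = ∂^{(∞)}(δ̃)`) gives `#Ш_an = q` with `ord_p q + ord_p ∏ c_ℓ = ord_p #Ш + d` (rank `0`, any
`p`, `E[p]` irreducible, GZK). [cite: Miller2011LMS, Def. 1.1 (arXiv:1010.2431 p. 3)]
[cite: Kim2022StructureSelmer, Thm. 1.9 (6) and §1.5.3 (PDF p. 8)] -/
theorem padicValRat_shaAn_eq_of_levelReading_eq (hGZK : rank_eq_analyticRank_of_analyticRank_le_one)
    (hirr : Irr W p) (hL : W.entireLFunction 1 ≠ 0) (d : ℕ)
    (hread : ∃ q : ℚ, W.entireLFunction 1 / (W.realPeriodRat : ℂ) = (q : ℂ) ∧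
      padicValRat p q = (padicValNat p (Nat.card (AddCommGroup.primaryComponent W.sha p)) : ℤ) + d) :
    ∃ q : ℚ, shaAn W = (q : ℂ) ∧
      padicValRat p q + padicValNat p W.tamagawaProduct = padicValNat p W.shaOrder + (d : ℤ) := by
  have hr0 : W.analyticRank = 0 := analyticRank_eq_zero_of_entireLFunction_one_ne_zero W hL
  obtain ⟨-, hfin⟩ := hGZK W (by rw [hr0]; exact zero_le_one)
  haveI : Finite W.sha := hfin
  obtain ⟨t, ht, hval⟩ := hread
  have hΩC : (W.realPeriodRat : ℂ) ≠ 0 := Complex.ofReal_ne_zero.mpr W.realPeriodRat_pos_holds.ne'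
  have ht0 : t ≠ 0 := by
    rintro rfl
    apply hL
    have h := ht
    rw [div_eq_iff hΩC] at h
    rw [h]; simp
  have hsha : padicValNat p (Nat.card (AddCommGroup.primaryComponent W.sha p)) =
      padicValNat p W.shaOrder := by
    unfold WeierstrassCurve.shaOrder
    exact padicValNat_card_addPrimaryComponent p
  refine ⟨t * (W.torsionOrder : ℚ) ^ 2 / (W.tamagawaProduct : ℚ),
    shaAn_eq_of_analyticRank_eq_zero W hGZK hr0 ht, ?_⟩
  rw [padicValRat_shaAn_witness W p hirr ht0, ← hsha]
  linarith

omit [W.IsGloballyMinimal] in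
/-- **With an EXACT level reading of slack `d`, `BSD(E,p) ↔ d = ord_p ∏ c_ℓ`** (rank `0`, any `p`,
`E[p]` irreducible, GZK) — the currency form of Kim's expected equality `∂^{(∞)}(δ̃) = ∑_ℓ ord_p c_ℓ`
(§1.5.3), generalising additive-p3's `X4.bsdp_iff_not_dvd_tamagawaProduct_of_rankZero_witness` (`d = 0`).
[cite: Miller2011LMS, Def. 1.1 (arXiv:1010.2431 p. 3)] [cite: Kim2022StructureSelmer, §1.5.3 (PDF p. 8)] -/
theorem bsdp_iff_of_levelReading_eq (hGZK : rank_eq_analyticRank_of_analyticRank_le_one)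
    (hirr : Irr W p) (hL : W.entireLFunction 1 ≠ 0) (d : ℕ)
    (hread : ∃ q : ℚ, W.entireLFunction 1 / (W.realPeriodRat : ℂ) = (q : ℂ) ∧
      padicValRat p q = (padicValNat p (Nat.card (AddCommGroup.primaryComponent W.sha p)) : ℤ) + d) :
    BSDp W p ↔ d = padicValNat p W.tamagawaProduct := by
  have hr0 : W.analyticRank = 0 := analyticRank_eq_zero_of_entireLFunction_one_ne_zero W hL
  obtain ⟨hrank, hfin⟩ := hGZK W (by rw [hr0]; exact zero_le_one)
  haveI : Finite W.sha := hfin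
  obtain ⟨q, hq, hv⟩ := padicValRat_shaAn_eq_of_levelReading_eq W p hGZK hirr hL d hread
  constructor
  · intro h
    obtain ⟨q', hq', hv'⟩ := missingPPartAt_of_bsdp W p h
    have hqq : q' = q := by exact_mod_cast hq'.symm.trans hq
    subst hqq
    have : (d : ℤ) = (padicValNat p W.tamagawaProduct : ℤ) := by linarith
    exact_mod_cast this
  · intro hd
    subst hd
    refine bsdp_of_missingPPartAt W p hGZK (by rw [hr0]; exact zero_le_one) ⟨q, hq, ?_⟩
    linarith

end Summit.BirchSwinnertonDyer.Rank1Residual.X4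

end
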